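import Mathlib

/-!
# Uniform word contraction ⇒ word decay (stub `stub_wordDecayOfUWC`)

The stub `stub_wordDecayOfUWC` of the crux `MobiusLadder.QuadraticDigitPhases`
(stmt-QuantumAdvantage-1391), line `Sketch`, with its (elementary) lemmas.  Mathlib only.

The pair-carry chain of `T ↦ (pT, qT)` has states `(r, r') ∈ [0,p) × [0,q)`; the digit `t ∈ {0,1}`
moves `(r, r') ↦ (⌊(pt + r)/2⌋, ⌊(qt + r')/2⌋)` with weight `1/2`, and a letter `ab ∈ Bool × Bool`
twists the move by the output bits.  Each letter matrix `M_{ab}` is an `ℓ¹`-contraction on row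
vectors (`sum_abs_letter_le`, `l1_vecMul_le`), and the states reachable from `(0,0)`, namely
`(⌊pT/2^c⌋, ⌊qT/2^c⌋)` with `T < 2^c`, are closed under the moves (`reach_step`).  If every word
with `≥ m` twisted letters has absolute row sums `≤ K < 1` at the reachable states (uniform word
contraction), then a word with `≥ m j` twisted letters splits into `j` such blocks and a tail
(`exists_split_filter`), so by submultiplicativity its row at `(0,0)` has `ℓ¹`-norm `≤ max(K,0)^j`
(`l1_vecMul_prod_le_pow`), which is `≤ δ` for `j` large: this is `stub_wordDecayOfUWC`.
-/

set_option linter.dupNamespace false -- D-0017: single-problem summit ⇒ `QuantumAdvantage.QuantumAdvantage` by design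

namespace Summit.QuantumAdvantage.QuantumAdvantage.Theorems.MobiusLadderQuadraticDigitPhasesStubWordDecayOfUWC

open Finset
open scoped Matrix

/-- `ℓ¹ → ℓ¹` bound for row vectors: if the rows of `U` at the states carrying `v` have absolute
row sums `≤ K`, then `‖v U‖₁ ≤ K ‖v‖₁`. -/
theorem l1_vecMul_le {ι : Type*} [Fintype ι] (R : ι → Prop) (U : Matrix ι ι ℝ) (K : ℝ)
    (hU : ∀ s, R s → ∑ y, |U s y| ≤ K) (v : ι → ℝ) (hv : ∀ s, v s ≠ 0 → R s) :
    ∑ y, |(v ᵥ* U) y| ≤ K * ∑ s, |v s| := by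
  have h1 : ∀ y, (v ᵥ* U) y = ∑ s, v s * U s y := fun y => rfl
  simp_rw [h1]
  calc ∑ y, |∑ s, v s * U s y| ≤ ∑ y, ∑ s, |v s| * |U s y| := Finset.sum_le_sum fun y _ =>
        (Finset.abs_sum_le_sum_abs _ _).trans_eq (Finset.sum_congr rfl fun s _ => abs_mul _ _)
    _ = ∑ s, |v s| * ∑ y, |U s y| := by rw [Finset.sum_comm]; simp_rw [Finset.mul_sum]
    _ ≤ ∑ s, |v s| * K := Finset.sum_le_sum fun s _ => ?_
    _ = K * ∑ s, |v s| := by rw [← Finset.sum_mul, mul_comm]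
  by_cases hs : v s = 0
  · rw [hs, abs_zero, zero_mul, zero_mul]
  · exact mul_le_mul_of_nonneg_left (hU s (hv s hs)) (abs_nonneg _)

/-- A nonzero entry `(v U)_y` comes from a state `s` carrying `v` with `U s y ≠ 0`. -/
theorem exists_of_vecMul_ne_zero {ι : Type*} [Fintype ι] (U : Matrix ι ι ℝ) (v : ι → ℝ) (y : ι)
    (h : (v ᵥ* U) y ≠ 0) : ∃ s, v s ≠ 0 ∧ U s y ≠ 0 := by
  have h' : ∑ s, v s * U s y ≠ 0 := h
  obtain ⟨s, -, hs⟩ := Finset.exists_ne_zero_of_sum_ne_zero h'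
  exact ⟨s, left_ne_zero_of_mul hs, right_ne_zero_of_mul hs⟩

/-- Reachability propagates along words: if `v` is carried by `R`-states and nonzero entries of
every letter lead from `R`-states to `R`-states, then `v M_{ℓ₁} ⋯ M_{ℓ_k}` is carried by
`R`-states. -/
theorem support_vecMul_prod {ι L : Type*} [Fintype ι] [DecidableEq ι] (R : ι → Prop)
    (M : L → Matrix ι ι ℝ) (hstep : ∀ a s y, R s → M a s y ≠ 0 → R y) :
    ∀ (word : List L) (v : ι → ℝ), (∀ s, v s ≠ 0 → R s) →
      ∀ y, (v ᵥ* (word.map M).prod) y ≠ 0 → R y := by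
  intro word
  induction word with
  | nil =>
    intro v hv y hy
    rw [List.map_nil, List.prod_nil, Matrix.vecMul_one] at hy
    exact hv y hy
  | cons a w ih =>
    intro v hv y hy
    rw [List.map_cons, List.prod_cons, ← Matrix.vecMul_vecMul] at hy
    refine ih _ (fun s hs => ?_) y hy
    obtain ⟨r, hr, hrs⟩ := exists_of_vecMul_ne_zero _ _ _ hs
    exact hstep a r s (hv r hr) hrs

/-- Words are `ℓ¹`-contractions on row vectors as soon as every letter has absolute row sums
`≤ 1`. -/
theorem l1_vecMul_prod_le {ι L : Type*} [Fintype ι] [DecidableEq ι] (M : L → Matrix ι ι ℝ)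
    (hrow : ∀ a x, ∑ y, |M a x y| ≤ 1) :
    ∀ (word : List L) (v : ι → ℝ), ∑ y, |(v ᵥ* (word.map M).prod) y| ≤ ∑ s, |v s| := by
  intro word
  induction word with
  | nil =>
    intro v
    rw [List.map_nil, List.prod_nil, Matrix.vecMul_one]
  | cons a w ih =>
    intro v
    rw [List.map_cons, List.prod_cons, ← Matrix.vecMul_vecMul]
    refine (ih _).trans ?_
    have h := l1_vecMul_le (fun _ => True) (M a) 1 (fun s _ => hrow a s) v (fun _ _ => trivial)
    rwa [one_mul] at h

/-- A list with at least `m` marked entries has a prefix with exactly `m` marked entries. -/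
theorem exists_split_filter {L : Type*} (P : L → Bool) :
    ∀ (l : List L) (m : ℕ), m ≤ (l.filter P).length →
      ∃ l₁ l₂ : List L, l = l₁ ++ l₂ ∧ (l₁.filter P).length = m := by
  intro l
  induction l with
  | nil =>
    intro m hm
    refine ⟨[], [], rfl, ?_⟩
    simp only [List.filter_nil, List.length_nil] at hm ⊢
    omega
  | cons a l ih =>
    intro m hm
    rcases Nat.eq_zero_or_pos m with rfl | hm0
    · exact ⟨[], a :: l, rfl, rfl⟩
    · by_cases ha : P a = true
      · rw [List.filter_cons_of_pos ha, List.length_cons] at hm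
        obtain ⟨l₁, l₂, rfl, hl₁⟩ := ih (m - 1) (by omega)
        refine ⟨a :: l₁, l₂, rfl, ?_⟩
        rw [List.filter_cons_of_pos ha, List.length_cons, hl₁]
        omega
      · rw [List.filter_cons_of_neg ha] at hm
        obtain ⟨l₁, l₂, rfl, hl₁⟩ := ih m hm
        exact ⟨a :: l₁, l₂, rfl, by rw [List.filter_cons_of_neg ha, hl₁]⟩

/-- SUBMULTIPLICATIVITY: if the words with `≥ m` marked letters have absolute row sums `≤ K`
(`0 ≤ K`) at the `R`-states, and the letters are `ℓ¹`-contractions whose nonzero entries lead from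
`R`-states to `R`-states, then a word with `≥ m j` marked letters maps a row vector carried by
`R`-states to one of `ℓ¹`-norm at most `K^j` times its norm (split off `j` blocks with `m` marked
letters each; the tail only contracts). -/
theorem l1_vecMul_prod_le_pow {ι L : Type*} [Fintype ι] [DecidableEq ι] (R : ι → Prop)
    (M : L → Matrix ι ι ℝ) (P : L → Bool) (m : ℕ) (K : ℝ) (hK : 0 ≤ K)
    (hrow : ∀ a x, ∑ y, |M a x y| ≤ 1) (hstep : ∀ a s y, R s → M a s y ≠ 0 → R y)
    (hU : ∀ u : List L, m ≤ (u.filter P).length → ∀ s, R s → ∑ y, |(u.map M).prod s y| ≤ K) :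
    ∀ (j : ℕ) (word : List L), m * j ≤ (word.filter P).length → ∀ v : ι → ℝ,
      (∀ s, v s ≠ 0 → R s) → ∑ y, |(v ᵥ* (word.map M).prod) y| ≤ K ^ j * ∑ s, |v s| := by
  intro j
  induction j with
  | zero =>
    intro word _ v _
    rw [pow_zero, one_mul]
    exact l1_vecMul_prod_le M hrow word v
  | succ j ih =>
    intro word hw v hv
    rw [mul_add_one] at hw
    obtain ⟨u, rest, rfl, hu⟩ := exists_split_filter P word m (by omega)
    rw [List.filter_append, List.length_append, hu] at hw
    rw [List.map_append, List.prod_append, ← Matrix.vecMul_vecMul]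
    calc ∑ y, |((v ᵥ* (u.map M).prod) ᵥ* (rest.map M).prod) y|
        ≤ K ^ j * ∑ s, |(v ᵥ* (u.map M).prod) s| :=
          ih rest (by omega) _ (support_vecMul_prod R M hstep u v hv)
      _ ≤ K ^ j * (K * ∑ s, |v s|) :=
          mul_le_mul_of_nonneg_left (l1_vecMul_le R _ K (hU u hu.symm.le) v hv) (pow_nonneg hK j)
      _ = K ^ (j + 1) * ∑ s, |v s| := by rw [pow_succ, mul_assoc]

/-- Two half-weight digit moves, each hitting at most one state, give absolute row sums `≤ 1`. -/
theorem sum_abs_sum_pair_le {ι : Type*} [Fintype ι] (F : ℕ → ι → ℝ) (hF : ∀ t y, |F t y| ≤ 1 / 2)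
    (huniq : ∀ t y y', F t y ≠ 0 → F t y' ≠ 0 → y = y') :
    ∑ y, |∑ t ∈ ({0, 1} : Finset ℕ), F t y| ≤ 1 := by
  have ht : ∀ t, ∑ y, |F t y| ≤ 1 / 2 := by
    intro t
    by_cases h : ∃ y₀, F t y₀ ≠ 0
    · obtain ⟨y₀, hy₀⟩ := h
      rw [Finset.sum_eq_single y₀ (fun y _ hy => ?_) (fun h => absurd (Finset.mem_univ _) h)]
      · exact hF t y₀
      · rw [abs_eq_zero]
        by_contra hy'
        exact hy (huniq t y y₀ hy' hy₀)
    · push Not at h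
      rw [Finset.sum_eq_zero fun y _ => by rw [h y, abs_zero]]
      norm_num
  calc ∑ y, |∑ t ∈ ({0, 1} : Finset ℕ), F t y|
      ≤ ∑ y, ∑ t ∈ ({0, 1} : Finset ℕ), |F t y| :=
        Finset.sum_le_sum fun y _ => Finset.abs_sum_le_sum_abs _ _
    _ = ∑ t ∈ ({0, 1} : Finset ℕ), ∑ y, |F t y| := Finset.sum_comm
    _ ≤ ∑ t ∈ ({0, 1} : Finset ℕ), (1 / 2 : ℝ) := Finset.sum_le_sum fun t _ => ht t
    _ = 1 := by rw [Finset.sum_pair zero_ne_one]; norm_num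

/-- A twist factor `(-1)^n` (or `1`, untwisted) has absolute value `1`. -/
theorem abs_twist (b : Bool) (n : ℕ) : |(if b then (-1 : ℝ) ^ n else 1)| = 1 := by
  cases b <;> simp

-- adapted from …StubDwdOfWords.carry_succ (self-contained proof, kept private)
/-- One digit move keeps carries of the shape `⌊p T/2^c⌋`, `T < 2^c`:
`⌊p (2^c t + T) / 2^{c+1}⌋ = ⌊(p t + ⌊p T/2^c⌋)/2⌋`. -/
private theorem carry_step (p c t T : ℕ) :
    p * (2 ^ c * t + T) / 2 ^ (c + 1) = (p * t + p * T / 2 ^ c) / 2 := by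
  rw [pow_succ, ← Nat.div_div_eq_div_mul, show p * (2 ^ c * t + T) = p * T + p * t * 2 ^ c by ring,
    Nat.add_mul_div_right _ _ (Nat.two_pow_pos c), add_comm]

/-- Each pair-carry letter matrix is an `ℓ¹`-contraction on row vectors: `Σ_y |M_{ab} x y| ≤ 1`. -/
theorem sum_abs_letter_le {p q : ℕ} (M : Bool × Bool → Matrix (Fin p × Fin q) (Fin p × Fin q) ℝ)
    (hM : M = fun ab : Bool × Bool => (Matrix.of fun (x y : Fin p × Fin q) =>
      ∑ t ∈ ({0, 1} : Finset ℕ),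
        if (y.1 : ℕ) = (p * t + x.1) / 2 ∧ (y.2 : ℕ) = (q * t + x.2) / 2 then
          (1 / 2 : ℝ) * (if ab.1 then (-1 : ℝ) ^ ((p * t + x.1) % 2) else 1) *
            (if ab.2 then (-1 : ℝ) ^ ((q * t + x.2) % 2) else 1)
        else 0))
    (ab : Bool × Bool) (x : Fin p × Fin q) : ∑ y, |M ab x y| ≤ 1 := by
  subst hM
  simp only [Matrix.of_apply]
  refine sum_abs_sum_pair_le _ (fun t y => ?_) (fun t y y' h h' => ?_)
  · by_cases hc : (y.1 : ℕ) = (p * t + x.1) / 2 ∧ (y.2 : ℕ) = (q * t + x.2) / 2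
    · rw [if_pos hc]
      refine le_of_eq ?_
      rw [abs_mul, abs_mul, abs_twist, abs_twist, mul_one, mul_one]
      exact abs_of_pos (by norm_num)
    · rw [if_neg hc, abs_zero]
      norm_num
  · have hc : (y.1 : ℕ) = (p * t + x.1) / 2 ∧ (y.2 : ℕ) = (q * t + x.2) / 2 := by
      by_contra hc
      exact h (if_neg hc)
    have hc' : (y'.1 : ℕ) = (p * t + x.1) / 2 ∧ (y'.2 : ℕ) = (q * t + x.2) / 2 := by
      by_contra hc'
      exact h' (if_neg hc')
    exact Prod.ext (Fin.ext (hc.1.trans hc'.1.symm)) (Fin.ext (hc.2.trans hc'.2.symm))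

/-- The reachable states `(⌊pT/2^c⌋, ⌊qT/2^c⌋)`, `T < 2^c`, are closed under the letters: a nonzero
entry `M_{ab} s y` forces `y = (⌊pT'/2^{c+1}⌋, ⌊qT'/2^{c+1}⌋)` with `T' = 2^c t + T`. -/
theorem reach_step {p q : ℕ} (M : Bool × Bool → Matrix (Fin p × Fin q) (Fin p × Fin q) ℝ)
    (hM : M = fun ab : Bool × Bool => (Matrix.of fun (x y : Fin p × Fin q) =>
      ∑ t ∈ ({0, 1} : Finset ℕ),
        if (y.1 : ℕ) = (p * t + x.1) / 2 ∧ (y.2 : ℕ) = (q * t + x.2) / 2 then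
          (1 / 2 : ℝ) * (if ab.1 then (-1 : ℝ) ^ ((p * t + x.1) % 2) else 1) *
            (if ab.2 then (-1 : ℝ) ^ ((q * t + x.2) % 2) else 1)
        else 0))
    (ab : Bool × Bool) (s y : Fin p × Fin q)
    (hs : ∃ c T : ℕ, T < 2 ^ c ∧ (s.1 : ℕ) = p * T / 2 ^ c ∧ (s.2 : ℕ) = q * T / 2 ^ c)
    (h : M ab s y ≠ 0) :
    ∃ c T : ℕ, T < 2 ^ c ∧ (y.1 : ℕ) = p * T / 2 ^ c ∧ (y.2 : ℕ) = q * T / 2 ^ c := by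
  subst hM
  simp only [Matrix.of_apply] at h
  obtain ⟨t, ht, hty⟩ := Finset.exists_ne_zero_of_sum_ne_zero h
  have hc : (y.1 : ℕ) = (p * t + s.1) / 2 ∧ (y.2 : ℕ) = (q * t + s.2) / 2 := by
    by_contra hc
    exact hty (if_neg hc)
  obtain ⟨c, T, hT, hs1, hs2⟩ := hs
  have ht1 : t ≤ 1 := by
    simp only [Finset.mem_insert, Finset.mem_singleton] at ht
    omega
  have h2 : 2 ^ c * t ≤ 2 ^ c := mul_le_of_le_one_right (Nat.zero_le _) ht1
  refine ⟨c + 1, 2 ^ c * t + T, ?_, ?_, ?_⟩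
  · rw [pow_succ]
    omega
  · rw [hc.1, hs1, carry_step]
  · rw [hc.2, hs2, carry_step]

/-- UNIFORM WORD CONTRACTION ⇒ WORD DECAY (stub `stub_wordDecayOfUWC` of the crux, line `Sketch`):
if every word of pair-carry transfer matrices with at least `m` twisted letters has absolute row
sums `≤ K < 1` at the states reachable from `(0,0)`, then for every `δ > 0` the words with at least
`w = m j` twisted letters (`max(K,0)^j < δ`) map `e₀₀` to a row vector of `ℓ¹`-norm `≤ δ`.  Proof:
split the word into `j` blocks with `m` twisted letters each and a tail; push `e₀₀` through the
blocks (`l1_vecMul_prod_le_pow`: reachability is preserved by `reach_step`, each block contracts by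
`max(K,0)`, the tail by `1`). -/
theorem stub_wordDecayOfUWC :
    ∀ p q : ℕ, ∀ hp : p.Prime, ∀ hq : q.Prime, p ≠ q → 2 < p → 2 < q →
      (∃ m : ℕ, ∃ K : ℝ, K < 1 ∧ ∀ word : List (Bool × Bool),
        m ≤ (word.filter (fun ab => ab ≠ (false, false))).length →
        ∀ s : Fin p × Fin q, (∃ c T : ℕ, T < 2 ^ c ∧ (s.1 : ℕ) = p * T / 2 ^ c ∧ (s.2 : ℕ) = q * T / 2 ^ c) →
        ∑ y : Fin p × Fin q,
          |((word.map (fun ab : Bool × Bool =>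
            (Matrix.of fun (x y : Fin p × Fin q) =>
              ∑ t ∈ ({0, 1} : Finset ℕ),
                if (y.1 : ℕ) = (p * t + x.1) / 2 ∧ (y.2 : ℕ) = (q * t + x.2) / 2 then
                  (1 / 2 : ℝ) * (if ab.1 then (-1 : ℝ) ^ ((p * t + x.1) % 2) else 1) *
                    (if ab.2 then (-1 : ℝ) ^ ((q * t + x.2) % 2) else 1)
                else 0))).prod) s y| ≤ K) →
      (∀ δ : ℝ, 0 < δ → ∃ w : ℕ, ∀ word : List (Bool × Bool),
        w ≤ (word.filter (fun ab => ab ≠ (false, false))).length →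
        ∑ y : Fin p × Fin q,
          |((word.map (fun ab : Bool × Bool =>
            (Matrix.of fun (x y : Fin p × Fin q) =>
              ∑ t ∈ ({0, 1} : Finset ℕ),
                if (y.1 : ℕ) = (p * t + x.1) / 2 ∧ (y.2 : ℕ) = (q * t + x.2) / 2 then
                  (1 / 2 : ℝ) * (if ab.1 then (-1 : ℝ) ^ ((p * t + x.1) % 2) else 1) *
                    (if ab.2 then (-1 : ℝ) ^ ((q * t + x.2) % 2) else 1)
                else 0))).prod)
            (⟨0, hp.pos⟩, ⟨0, hq.pos⟩) y| ≤ δ) := by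
  intro p q hp hq _ _ _ hUWC δ hδ
  obtain ⟨m, K, hK1, hK⟩ := hUWC
  set M : Bool × Bool → Matrix (Fin p × Fin q) (Fin p × Fin q) ℝ := fun ab : Bool × Bool =>
    (Matrix.of fun (x y : Fin p × Fin q) =>
      ∑ t ∈ ({0, 1} : Finset ℕ),
        if (y.1 : ℕ) = (p * t + x.1) / 2 ∧ (y.2 : ℕ) = (q * t + x.2) / 2 then
          (1 / 2 : ℝ) * (if ab.1 then (-1 : ℝ) ^ ((p * t + x.1) % 2) else 1) *
            (if ab.2 then (-1 : ℝ) ^ ((q * t + x.2) % 2) else 1)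
        else 0) with hM
  have hK'0 : (0 : ℝ) ≤ max K 0 := le_max_right _ _
  have hK'1 : max K 0 < 1 := max_lt hK1 one_pos
  obtain ⟨j, hj⟩ := exists_pow_lt_of_lt_one hδ hK'1
  refine ⟨m * j, fun word hw => ?_⟩
  have hv : ∀ s : Fin p × Fin q,
      (Pi.single (⟨0, hp.pos⟩, ⟨0, hq.pos⟩) (1 : ℝ) : Fin p × Fin q → ℝ) s ≠ 0 →
      ∃ c T : ℕ, T < 2 ^ c ∧ (s.1 : ℕ) = p * T / 2 ^ c ∧ (s.2 : ℕ) = q * T / 2 ^ c := by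
    intro s hs
    have hs0 : s = (⟨0, hp.pos⟩, ⟨0, hq.pos⟩) := by
      by_contra hne
      exact hs (Pi.single_eq_of_ne hne _)
    subst hs0
    exact ⟨0, 0, by norm_num, by simp, by simp⟩
  have key := l1_vecMul_prod_le_pow
    (fun s : Fin p × Fin q =>
      ∃ c T : ℕ, T < 2 ^ c ∧ (s.1 : ℕ) = p * T / 2 ^ c ∧ (s.2 : ℕ) = q * T / 2 ^ c)
    M _ m (max K 0) hK'0 (sum_abs_letter_le M hM) (reach_step M hM)
    (fun u hu s hs => (hK u hu s hs).trans (le_max_left _ _)) j word hw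
    (Pi.single (⟨0, hp.pos⟩, ⟨0, hq.pos⟩) (1 : ℝ)) hv
  have h1 : ∑ s : Fin p × Fin q,
      |(Pi.single (⟨0, hp.pos⟩, ⟨0, hq.pos⟩) (1 : ℝ) : Fin p × Fin q → ℝ) s| = 1 := by
    rw [Finset.sum_eq_single_of_mem (⟨0, hp.pos⟩, ⟨0, hq.pos⟩) (Finset.mem_univ _)
      (fun s _ hs => by rw [Pi.single_eq_of_ne hs, abs_zero]), Pi.single_eq_same, abs_one]
  rw [Matrix.single_one_vecMul, Matrix.row_apply', h1, mul_one] at key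
  exact key.trans hj.le

end Summit.QuantumAdvantage.QuantumAdvantage.Theorems.MobiusLadderQuadraticDigitPhasesStubWordDecayOfUWC
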